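import Literature.MathematicalPhysics.QuantumFieldTheory.BalabanImbrieJaffe1984to88.BIJ85Ineq722AllTori
import Literature.MathematicalPhysics.QuantumFieldTheory.BalabanImbrieJaffe1984to88.BIJ85CurlyDkDecayTorus
import Literature.MathematicalPhysics.QuantumFieldTheory.BalabanImbrieJaffe1984to88.BIJ85Claim73ActualOne

/-!
# `BalabanImbrieJaffe1984to88.BIJ85Sect72AllTori` — T. Bałaban, J. Imbrie, A. Jaffe, *Renormalization of the Higgs model: minimizers,
propagators and the stability of mean field theory*, Commun. Math. Phys. **97** (1985) 299–329 [BalabanImbrieJaffe1985], Sect. 7.2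
pp. 325–326: **(7.2.2), (7.2.4) AND THE `𝒟_k`-DECAY SENTENCE OVER ALL TORI**, from [6I] = [Balaban1984PropagatorsI] Proposition 1.2
«by its tree name» in its ALL-TORI form (the subtype-indexed hypothesis of `BIJ85Ineq722AllTori`).

statement-level skeleton of published theorems with citation tags; proofs where landed; nothing here is a claim about the Yang–Mills mass gap

PDF held: `paper:balaban1985-cmp97-bij-higgs-minimizers` (pp. 325–326 = PDF 27–28), `paper:balaban1984-cmp95-propagators-rt-i`
(Prop. 1.2 pp. 35–36 = PDF 19–20); text layers re-read this session.

CITATION HEADER (lean-in-tree rule).  Part of the lit-balaban TYPED SKELETON (HOME `run/shared/lean/pub/lit-balaban/`), Phase-2 proof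
seat p16 gen 7 (third file; companions `BIJ85Prop12PerTower` p304326, `BIJ85Ineq722AllTori` p304594); rows **C1.Eq7.2.1-7.2.2** and
**C1.Eq7.2.4** (owner r15, referee ref-5).  The all-tori `B5.Prop12Printed` hypothesis itself is the target of the Prop. 1.2 family
bridge held by seat p19 gen 6 (`BIJ85Prop12Bridge*`); nothing here overlaps with it.

THE PRINTED TEXT (verbatim).  p. 325 [PDF 27]: *"there exists δ > 0 and for 0 ≤ α < 1 a constant M = M(α) < ∞ such that for
|x − x′| ≤ 1, |H_{k,μν}(x,y)| + |∇H_{k,μν}(x,y)| + |x − x′|^{−α}|∇H_{k,μν}(x,y) − ∇H_{k,μν}(x′,y)| ≤ Me^{−δ|x−y|}. (7.2.2) This inequality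
is a consequence of Proposition 1.2 and the representation (1.103) of [6I]."*  p. 326 [PDF 28]: *"The gauge transformation λ in (5.1.1)
is bounded and depends on B through an exponentially decaying kernel D_k: λ(x) = (D_kB)(x), |D_k(x, b)| ≤ Me^{−δdist(x,b)}. (7.2.4) This
estimate follows from (5.1.4) and (7.2.2). The operators 𝒟_k have the same properties as the operators G_k in [6I], Proposition 1.2,
with exponential decay but singularities on the diagonal. These properties follow from (4.4.4) and the above estimates on H_k, C^{(k)}."*
[6I] p. 35: *"with the constant O(1) depending on d only"*, p. 33: *"independent of k, T_η"* — every constant of Sect. 7.2 is uniform in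
the scale `k` AND in the torus `T_η` (every volume `L^m`, every `ε = L^{−K}`).

WHY THIS FILE.  The tree's per-tower forms (`BIJ85Ineq722Torus.ineq722_torusStd_of_prop12Printed`, `BIJ85Ineq722DeltaA.sect72_deltaA`,
`BIJ85CurlyDkDecayTorus.decayDk_torus_prop12`, …) fix ONE tower `P` and produce `∃`-constants after it; at a fixed tower the families are
finite, so such statements are true by finiteness (`BIJ85Prop12PerTower`, GAPS G-C1-07) and do not carry the printed uniformity.  Here
the SAME derivations (p09's explicit-constant lemmas `abs_H_le`/`abs_gradH_le`/`ineq724_torusKernelData`, p08's `abs_dkKernel_le`, p09's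
all-tori (7.2.3) `ineq723_CE_lt`) are run with the constants chosen BEFORE the torus.

WHAT IS PROVED (theorems only; no `def`, no Prop-valued fact).
* §1 `exists_enum_allTori`: an explicit (`Nat.unpair`) SURJECTION from `ℕ` onto the all-tori index
  `{(P, k) // P.d = d ∧ P.L = L ∧ 1 ≤ k ≤ m + K}`; hence **`ineq722_allTori_of_prop12Printed`**: r15's `KernelData.Ineq722` INHABITED BY
  THE ALL-TORI FAMILY (one `δ`, one `M(α)` along a surjective enumeration of every torus of dimension `d`, block size `L`, and every
  scale `1 ≤ k ≤ m + K`), from `BIJ85Ineq722AllTori.ineq722_deltaA_seq_of_prop12Printed` along the enumeration.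
* §2 the pointwise members of (7.2.2) with constants chosen before the torus: `absH_le_allTori` / `gradH_le_allTori` (explicit
  `const722`/`rate722` at the `(d, a)`-only structural constants of `BIJ85Ineq722AllTori.hyps_torus_deltaA_dim`),
  `prop12Hyps_allTori_of_prop12Printed` and `exists_absH_le_allTori_of_prop12Printed`.
* §3 the scale `k = 0` (outside print and outside the all-tori index, but a summand of (4.4.4)): `H_zero_apply` — `H_0 = I`
  (p33's `BIJ85Claim73ActualOne.HkE_zero` read through p08's kernel dictionary `ofLp_HkE_single`), `abs_H_zero_le`.
* §4 **(7.2.4) over all tori**: `ineq724_allTori` (explicit constants) / `exists_ineq724_allTori_of_prop12Printed` — ONE `(M, δ)` with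
  `KernelData.Ineq724 M δ` for p09's carrier with `D_k = Dk (L^k) k H_k` on EVERY torus (`P.d = d`, `P.L = L`) and every `1 ≤ k ≤ m + K`.
* §5 **the `𝒟_k` sentence over all tori**: `decayDk_allTori_of_prop12Printed` (`2 ≤ d`) — ONE `(R₀, c₀, δ′)` with
  `|𝒟_k(b, b″)| ≤ c₀e^{−δ′|b₋ − b″₋|_∞/L^k}` for `|b₋ − b″₋|_∞/L^k ≥ R₀`, for p11's `𝒟_k = DkE P η_k^d L^k k` on every torus and every `k ≤ m + K`.
HONEST SCOPE.  Pure re-quantification of tree theorems (p09 g4/g5, p08 g8, p33 g7, this seat's p304594); the analytic input other than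
[6I] Prop. 1.2 is (7.2.3) over all tori (p09 g6, hypothesis-free) and the structural `Hyps` (p09, theorems).  [6I] Prop. 1.2 enters as
the HYPOTHESIS `B5.Prop12Printed` over the all-tori index (or as `Prop12Hyps C Cα δ₀` uniform over all tori); it is NOT proved here.
`U = 1` real fields, torus, `ℓ^∞` distances as in the cited files (DIVERGENCE F2/F3 of those files apply verbatim).
-/

namespace Literature.MathematicalPhysics.QuantumFieldTheory.BalabanImbrieJaffe1984to88.BIJ85Sect72AllTori

open Literature.MathematicalPhysics.QuantumFieldTheory.Balaban1983to89 hiding Site Plaq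
open scoped BigOperators Matrix RealInnerProductSpace
open Balaban1983to89.LatticeFieldCalculus Balaban1983to89.B5Eq118OneStroke
open BIJ85Ineq722Proof BIJ85Ineq722Proof.Rep103 BIJ85Ineq722ProofPart2 BIJ85Sect7Statements BIJ85Ineq722Torus BIJ85Ineq722DeltaA
open BIJ85Ineq722AllTori BIJ85Ineq724Torus BIJ85AxialPropagator411 BIJ85Prop521Torus BIJ85Prop522Torus
open BIJ85Ineq724Proof (Dk)
open BIJ85CurlyDkDecayTorus (abs_dkKernel_le)
open BIJ85Ineq723TorusCE (ineq723_CE_lt)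
open BIJ85Claim73ActualOne (HkE_zero)
open BIJ88Ineq217Ineq722Torus (ofLp_HkE_single torusKernelData_distEU)
open BIJ85Eq721MinimizerKernel (gradH_eq torusKernelData_gradH torusKernelData_H)

open Balaban1983to89 renaming Site → TSite

noncomputable section

/-! ## §1  The all-tori index, its enumeration, and (7.2.2) as ONE `KernelData.Ineq722` over all tori

The ALL-TORI INDEX of dimension `d` and block size `L` is the subtype `{(P, k) // P.d = d ∧ P.L = L ∧ 1 ≤ k ≤ m + K}` of all pairs of a
torus `P : Params` of the series (any volume `L^m`, any `ε = L^{−K}`) and a scale — the index over which [6I] Prop. 1.2's constants are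
uniform (*"depending on d only … independent of k, T_η"*); it is written out literally below (as in `BIJ85Ineq722AllTori`). -/

/-- two parameter records with the same data fields are equal. [folklore] -/
private theorem params_ext {P P' : Params} (h1 : P.d = P'.d) (h2 : P.L = P'.L) (h3 : P.m = P'.m) (h4 : P.K = P'.K) :
    P = P' := by
  cases P; cases P'; simp only at h1 h2 h3 h4; subst h1; subst h2; subst h3; subst h4; rfl

/-- `1 ≤ m + K` for the step count `K = K₀ + 1` (`m = 0`) / `K₀` (`m ≠ 0`) of the enumeration. [folklore] -/
private theorem one_le_add_ite (m K₀ : ℕ) : 1 ≤ m + (if m = 0 then K₀ + 1 else K₀) := by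
  split_ifs <;> omega

/-- **AN ENUMERATION OF ALL TORI AND SCALES** of dimension `d`, block size `L`: there is a SURJECTION from `ℕ` onto the all-tori index
(`n ↦ (m, K₀, k₀)` by `Nat.unpair` twice, then the torus `⟨d, L, m, K⟩`, `K = K₀ + 1` if `m = 0` else `K₀` — so that `m + K ≥ 1` — at the
scale `min (k₀ + 1) (m + K)`): every torus `T_η` (every volume `L^m`, every `ε = L^{−K}` of the series' parameter record, B12 (0.1)) and
every scale `1 ≤ k ≤ m + K` of [6I] Prop. 1.2's range *"independent of k, T_η"* occurs. [cite: Balaban1984PropagatorsI, Prop. 1.2 p.35] -/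
theorem exists_enum_allTori (d L : ℕ) (hd : 1 ≤ d) (hL : Odd L ∧ 1 < L) :
    ∃ e : ℕ → {x : Params × ℕ // x.1.d = d ∧ x.1.L = L ∧ 1 ≤ x.2 ∧ x.2 ≤ x.1.m + x.1.K}, Function.Surjective e := by
  refine ⟨fun n => ⟨(⟨d, L, n.unpair.1, (if n.unpair.1 = 0 then n.unpair.2.unpair.1 + 1 else n.unpair.2.unpair.1), hd, hL⟩,
      min (n.unpair.2.unpair.2 + 1) (n.unpair.1 + (if n.unpair.1 = 0 then n.unpair.2.unpair.1 + 1 else n.unpair.2.unpair.1))),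
    rfl, rfl, le_min (Nat.succ_le_succ (Nat.zero_le _)) (one_le_add_ite _ _), min_le_right _ _⟩, ?_⟩
  rintro ⟨⟨P, k⟩, hPd, hPL, hk1, hk⟩
  simp only at hPd hPL hk1 hk
  refine ⟨Nat.pair P.m (Nat.pair (if P.m = 0 then P.K - 1 else P.K) (k - 1)), Subtype.ext (Prod.ext ?_ ?_)⟩
  · refine params_ext hPd.symm hPL.symm ?_ ?_
    · show (Nat.unpair (Nat.pair P.m (Nat.pair (if P.m = 0 then P.K - 1 else P.K) (k - 1)))).1 = P.m
      rw [Nat.unpair_pair]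
    · show (if (Nat.unpair (Nat.pair P.m (Nat.pair (if P.m = 0 then P.K - 1 else P.K) (k - 1)))).1 = 0 then
          (Nat.unpair (Nat.unpair (Nat.pair P.m (Nat.pair (if P.m = 0 then P.K - 1 else P.K) (k - 1)))).2).1 + 1 else
          (Nat.unpair (Nat.unpair (Nat.pair P.m (Nat.pair (if P.m = 0 then P.K - 1 else P.K) (k - 1)))).2).1) = P.K
      simp only [Nat.unpair_pair]
      split_ifs with hm <;> omega
  · show min ((Nat.unpair (Nat.unpair (Nat.pair P.m (Nat.pair (if P.m = 0 then P.K - 1 else P.K) (k - 1)))).2).2 + 1)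
        ((Nat.unpair (Nat.pair P.m (Nat.pair (if P.m = 0 then P.K - 1 else P.K) (k - 1)))).1 +
          (if (Nat.unpair (Nat.pair P.m (Nat.pair (if P.m = 0 then P.K - 1 else P.K) (k - 1)))).1 = 0 then
            (Nat.unpair (Nat.unpair (Nat.pair P.m (Nat.pair (if P.m = 0 then P.K - 1 else P.K) (k - 1)))).2).1 + 1 else
            (Nat.unpair (Nat.unpair (Nat.pair P.m (Nat.pair (if P.m = 0 then P.K - 1 else P.K) (k - 1)))).2).1)) = k
    simp only [Nat.unpair_pair]
    split_ifs with hm <;> omega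

/-- **ROW C1.Eq7.2.1-7.2.2 OVER ALL TORI — r15's `KernelData.Ineq722` INHABITED BY THE ALL-TORI FAMILY**: given [6I] Prop. 1.2 by its
tree name over the all-tori index (`B5.Prop12Printed` for p09's carriers `settingOf (torusRep P k (deltaAData …)) k`, constants before
the torus), the typed display (7.2.2) holds with ONE `δ > 0` and, for each `0 ≤ α < 1`, ONE `M(α)` along an enumeration `e` of ALL tori
`T_η` of dimension `d`, block size `L` (every volume, every `ε`) and ALL scales `1 ≤ k ≤ m + K` (`e` surjective) — p. 325 *"there exists
δ > 0 and for 0 ≤ α < 1 a constant M = M(α) < ∞ …"* with the uniformity of [6I] p. 33 *"independent of k, T_η"*; the unit-lattice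
members `BondU`, `distEB`, `Cker`, `Dker` of the carrier are free, as in `BIJ85Ineq722Torus`. [cite: BalabanImbrieJaffe1985, (7.2.2) p.325] -/
theorem ineq722_allTori_of_prop12Printed {d L : ℕ} (hd : 1 ≤ d) (hL : Odd L ∧ 1 < L) {a : ℝ} (ha : 0 < a)
    (h12 : B5.Prop12Printed (fun i : {x : Params × ℕ // x.1.d = d ∧ x.1.L = L ∧ 1 ≤ x.2 ∧ x.2 ≤ x.1.m + x.1.K} =>
      settingOf (torusRep i.1.1 i.1.2 (deltaAData i.2.2.2.2 a)) i.1.2))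
    (BondU : {x : Params × ℕ // x.1.d = d ∧ x.1.L = L ∧ 1 ≤ x.2 ∧ x.2 ≤ x.1.m + x.1.K} → Type)
    (distEB : (i : {x : Params × ℕ // x.1.d = d ∧ x.1.L = L ∧ 1 ≤ x.2 ∧ x.2 ≤ x.1.m + x.1.K}) → TSite i.1.1 0 → BondU i → ℝ)
    (Cker : (i : {x : Params × ℕ // x.1.d = d ∧ x.1.L = L ∧ 1 ≤ x.2 ∧ x.2 ≤ x.1.m + x.1.K}) →
      Fin i.1.1.d → Fin i.1.1.d → TSite i.1.1 i.1.2 → TSite i.1.1 i.1.2 → ℝ)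
    (Dker : (i : {x : Params × ℕ // x.1.d = d ∧ x.1.L = L ∧ 1 ≤ x.2 ∧ x.2 ≤ x.1.m + x.1.K}) → TSite i.1.1 0 → BondU i → ℝ) :
    ∃ e : ℕ → {x : Params × ℕ // x.1.d = d ∧ x.1.L = L ∧ 1 ≤ x.2 ∧ x.2 ≤ x.1.m + x.1.K}, Function.Surjective e ∧
      KernelData.Ineq722 (fun n => torusKernelData (e n).1.1 (e n).1.2 (deltaAData (e n).2.2.2.2 a) (BondU (e n)) (distEB (e n))
        (Cker (e n)) (Dker (e n))) := by
  obtain ⟨e, he⟩ := exists_enum_allTori d L hd hL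
  exact ⟨e, he, ineq722_deltaA_seq_of_prop12Printed ha h12 (fun n => (e n).1.1) (fun n => (e n).2.1) (fun n => (e n).2.2.1)
    (fun n => (e n).1.2) (fun n => (e n).2.2.2.1) (fun n => (e n).2.2.2.2) (fun n => BondU (e n)) (fun n => distEB (e n))
    (fun n => Cker (e n)) fun n => Dker (e n)⟩

/-! ## §2  The pointwise members of (7.2.2) with constants chosen before the torus -/

/-- `|Dir| = d` for a torus of dimension `d`. [folklore] -/
private theorem card_dir_eq' {P : Params} {k : ℕ} {D : TorusData P k} {d : ℕ} (hPd : P.d = d) :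
    Fintype.card (torusRep P k D).Dir = d := by
  rw [← hPd]; exact Fintype.card_fin P.d

/-- **`|H_{k,μν}(x, y)| ≤ const·e^{δ/2}·e^{−δ|x − y|}` ON EVERY TORUS, constants before the torus**: for all `P` with `P.d = d` and all
`k ≤ m + K` at which the three [6I] Prop. 1.2 members hold with constants `(C, C_α, δ₀)`, p09's `abs_H_le` at the `(d, a)`-only structural
constants gives `|H((x,μ),(y,ν))| ≤ const722(d,…)·e^{rate722(d,…)/2}·e^{−rate722(d,…)·|x − y|}` (`|x − y|` = `distEU`, `|x − y| ≤ |y_x − y| + ½`).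
[cite: BalabanImbrieJaffe1985, (7.2.2) p.325] -/
theorem absH_le_allTori {d : ℕ} {a C δ₀ : ℝ} {Cα : ℝ → ℝ} (ha : 0 < a) {P : Params} (hPd : P.d = d) {k : ℕ} (hk : k ≤ P.m + P.K)
    (h12 : (torusRep P k (deltaAData hk a)).Prop12Hyps C Cα δ₀) (μ ν : Fin P.d) (x : TSite P 0) (y : TSite P k) :
    |(torusRep P k (deltaAData hk a)).H (x, μ) (y, ν)| ≤
      const722 d C δ₀ (T4GaugeActionRate.gam0 d / (4 * d + a)) 1 1 1 (fun t : ℝ => (2 * (1 + (d : ℝ) / t)) ^ d) *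
          Real.exp (rate722 d C δ₀ (T4GaugeActionRate.gam0 d / (4 * d + a)) 1 1 1 (fun t : ℝ => (2 * (1 + (d : ℝ) / t)) ^ d) * (1 / 2)) *
        Real.exp (-(rate722 d C δ₀ (T4GaugeActionRate.gam0 d / (4 * d + a)) 1 1 1 (fun t : ℝ => (2 * (1 + (d : ℝ) / t)) ^ d) * distEU P k x y)) := by
  have hH := hyps_torus_deltaA_dim hPd hk ha
  have h := abs_H_le hH h12 (x, μ) (y, ν)
  rw [card_dir_eq' hPd] at h
  set r := rate722 d C δ₀ (T4GaugeActionRate.gam0 d / (4 * d + a)) 1 1 1 (fun t : ℝ => (2 * (1 + (d : ℝ) / t)) ^ d) with hr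
  set c := const722 d C δ₀ (T4GaugeActionRate.gam0 d / (4 * d + a)) 1 1 1 (fun t : ℝ => (2 * (1 + (d : ℝ) / t)) ^ d) with hc
  have hrpos : 0 < r := rate722_pos hH h12 d
  have hc0 : 0 ≤ c := const722_nonneg hH h12 d
  have hdist : distEU P k x y ≤ (torusRep P k (deltaAData hk a)).dY ((torusRep P k (deltaAData hk a)).blk x) y + 1 / 2 :=
    distEU_le hk x y
  refine h.trans ?_
  rw [mul_assoc, ← Real.exp_add]
  refine mul_le_mul_of_nonneg_left (Real.exp_le_exp.2 ?_) hc0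
  nlinarith

/-- **`|∇H_{k,μν}(x, y)| ≤ const·e^{δ/2}·e^{−δ|x − y|}` ON EVERY TORUS, constants before the torus** (the `|∇H|` member of p09's Sect. 7.2
carrier = `max_λ|∇_λH_{k,μν}(x, y)|`, each component by p09's `abs_gradH_le`). [cite: BalabanImbrieJaffe1985, (7.2.2) p.325] -/
theorem gradH_le_allTori {d : ℕ} {a C δ₀ : ℝ} {Cα : ℝ → ℝ} (ha : 0 < a) {P : Params} (hPd : P.d = d) {k : ℕ} (hk : k ≤ P.m + P.K)
    (h12 : (torusRep P k (deltaAData hk a)).Prop12Hyps C Cα δ₀) (BondU : Type) (distEB : TSite P 0 → BondU → ℝ)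
    (Cker : Fin P.d → Fin P.d → TSite P k → TSite P k → ℝ) (Dker : TSite P 0 → BondU → ℝ)
    (μ ν : Fin P.d) (x : TSite P 0) (y : TSite P k) :
    (torusKernelData P k (deltaAData hk a) BondU distEB Cker Dker).gradH μ ν x y ≤
      const722 d C δ₀ (T4GaugeActionRate.gam0 d / (4 * d + a)) 1 1 1 (fun t : ℝ => (2 * (1 + (d : ℝ) / t)) ^ d) *
          Real.exp (rate722 d C δ₀ (T4GaugeActionRate.gam0 d / (4 * d + a)) 1 1 1 (fun t : ℝ => (2 * (1 + (d : ℝ) / t)) ^ d) * (1 / 2)) *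
        Real.exp (-(rate722 d C δ₀ (T4GaugeActionRate.gam0 d / (4 * d + a)) 1 1 1 (fun t : ℝ => (2 * (1 + (d : ℝ) / t)) ^ d) * distEU P k x y)) := by
  have hH := hyps_torus_deltaA_dim hPd hk ha
  set r := rate722 d C δ₀ (T4GaugeActionRate.gam0 d / (4 * d + a)) 1 1 1 (fun t : ℝ => (2 * (1 + (d : ℝ) / t)) ^ d) with hr
  set c := const722 d C δ₀ (T4GaugeActionRate.gam0 d / (4 * d + a)) 1 1 1 (fun t : ℝ => (2 * (1 + (d : ℝ) / t)) ^ d) with hc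
  have hrpos : 0 < r := rate722_pos hH h12 d
  have hc0 : 0 ≤ c := const722_nonneg hH h12 d
  have hdist : distEU P k x y ≤ (torusRep P k (deltaAData hk a)).dY ((torusRep P k (deltaAData hk a)).blk x) y + 1 / 2 :=
    distEU_le hk x y
  rw [torusKernelData_gradH hk a]
  refine (pi_norm_le_iff_of_nonneg (by positivity)).2 fun lam => ?_
  have h := abs_gradH_le hH h12 (x, lam, μ) (y, ν)
  rw [card_dir_eq' hPd, gradH_eq hk a x lam μ] at h
  rw [Real.norm_eq_abs]
  refine h.trans ?_
  rw [mul_assoc, ← Real.exp_add]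
  refine mul_le_mul_of_nonneg_left (Real.exp_le_exp.2 ?_) hc0
  show -(r * (torusRep P k (deltaAData hk a)).dY ((torusRep P k (deltaAData hk a)).blk x) y) ≤ r * (1 / 2) + -(r * distEU P k x y)
  nlinarith

/-- **[6I] Prop. 1.2 «by its tree name over all tori» read as uniform `Prop12Hyps`**: `B5.Prop12Printed` over the all-tori index gives ONE
`(C, C_α, δ₀)` with p09's `Prop12Hyps C C_α δ₀` for EVERY torus `P` (`P.d = d`, `P.L = L`) and EVERY scale `1 ≤ k ≤ m + K`.
[cite: Balaban1984PropagatorsI, Prop. 1.2 p.35] -/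
theorem prop12Hyps_allTori_of_prop12Printed {d L : ℕ} {a : ℝ}
    (h12 : B5.Prop12Printed (fun i : {x : Params × ℕ // x.1.d = d ∧ x.1.L = L ∧ 1 ≤ x.2 ∧ x.2 ≤ x.1.m + x.1.K} =>
      settingOf (torusRep i.1.1 i.1.2 (deltaAData i.2.2.2.2 a)) i.1.2)) :
    ∃ (C δ₀ : ℝ) (Cα : ℝ → ℝ), 0 < C ∧ 0 < δ₀ ∧ ∀ (P : Params) (hPd : P.d = d) (hPL : P.L = L) (k : ℕ) (hk1 : 1 ≤ k)
      (hk : k ≤ P.m + P.K), (torusRep P k (deltaAData hk a)).Prop12Hyps C Cα δ₀ := by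
  obtain ⟨δ₀, C, Cα, Cε, Cαε, hδ₀, hC, hall⟩ := h12
  exact ⟨C, δ₀, Cα, hC, hδ₀, fun P hPd hPL k hk1 hk =>
    prop12Hyps_of_ineq110_114 hC.le hδ₀ (hall ⟨(P, k), hPd, hPL, hk1, hk⟩)⟩

/-- **THE `|H|` MEMBER OF (7.2.2) OVER ALL TORI FROM [6I] PROP. 1.2 BY ITS TREE NAME**: `∃ δ > 0, M ≥ 1` with `|H_{k,μν}(x, y)| ≤ Me^{−δ|x − y|}`
for EVERY torus `P` (`P.d = d`, `P.L = L`), EVERY scale `1 ≤ k ≤ m + K`, all `μ ν x y` — *"independent of k, T_η"*. (`M ≥ 1` is a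
convenience for the scale-0 summand of (4.4.4), §3.) [cite: BalabanImbrieJaffe1985, (7.2.2) p.325] -/
theorem exists_absH_le_allTori_of_prop12Printed {d L : ℕ} (hd : 1 ≤ d) (hL : Odd L ∧ 1 < L) {a : ℝ} (ha : 0 < a)
    (h12 : B5.Prop12Printed (fun i : {x : Params × ℕ // x.1.d = d ∧ x.1.L = L ∧ 1 ≤ x.2 ∧ x.2 ≤ x.1.m + x.1.K} =>
      settingOf (torusRep i.1.1 i.1.2 (deltaAData i.2.2.2.2 a)) i.1.2)) :
    ∃ δ M : ℝ, 0 < δ ∧ 1 ≤ M ∧ ∀ (P : Params) (hPd : P.d = d) (hPL : P.L = L) (k : ℕ) (hk1 : 1 ≤ k) (hk : k ≤ P.m + P.K)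
      (μ ν : Fin P.d) (x : TSite P 0) (y : TSite P k),
      |(torusRep P k (deltaAData hk a)).H (x, μ) (y, ν)| ≤ M * Real.exp (-(δ * distEU P k x y)) := by
  obtain ⟨C, δ₀, Cα, hC, hδ₀, hall⟩ := prop12Hyps_allTori_of_prop12Printed h12
  -- a witness torus for the positivity of the rate: `P₀ = ⟨d, L, 0, 1⟩`, scale 1
  set P₀ : Params := ⟨d, L, 0, 1, hd, hL⟩ with hP₀
  have hk₀ : 1 ≤ P₀.m + P₀.K := le_rfl
  have hH₀ := hyps_torus_deltaA_dim (P := P₀) (d := d) rfl hk₀ ha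
  have h12₀ := hall P₀ rfl rfl 1 le_rfl hk₀
  set r := rate722 d C δ₀ (T4GaugeActionRate.gam0 d / (4 * d + a)) 1 1 1 (fun t : ℝ => (2 * (1 + (d : ℝ) / t)) ^ d) with hr
  set c := const722 d C δ₀ (T4GaugeActionRate.gam0 d / (4 * d + a)) 1 1 1 (fun t : ℝ => (2 * (1 + (d : ℝ) / t)) ^ d) with hc
  have hrpos : 0 < r := rate722_pos hH₀ h12₀ d
  refine ⟨r, max 1 (c * Real.exp (r * (1 / 2))), hrpos, le_max_left _ _, fun P hPd hPL k hk1 hk μ ν x y => ?_⟩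
  exact (absH_le_allTori ha hPd hk (hall P hPd hPL k hk1 hk) μ ν x y).trans
    (mul_le_mul_of_nonneg_right (le_max_right _ _) (Real.exp_pos _).le)

/-! ## §3  The scale `k = 0`: `Q_0 = I`, hence `H_0 = G_0Q_0^*(Q_0G_0Q_0^*)⁻¹ = I` -/

/-- **`H_0 = I`**: at scale `0` the averaging operator is the identity, so the (1.103) kernel of p09's torus instance is the identity
kernel, `H_0((z,κ),(y,ν)) = δ_{(z,κ),(y,ν)}` — p33's `HkE_zero` (`H_0 = id` for p11's Landau minimizer) read through p08's kernel dictionary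
`ofLp_HkE_single`. (Scale 0 is outside [6I]'s `k ≥ 1` and outside the all-tori index; it enters (4.4.4) as the `j = 0` summand.)
[cite: BalabanImbrieJaffe1985, (4.4.2) p.312] -/
theorem H_zero_apply {P : Params} (h0 : 0 ≤ P.m + P.K) {a : ℝ} (ha : 0 < a) (z y : TSite P 0) (κ ν : Fin P.d) :
    (torusRep P 0 (deltaAData h0 a)).H (z, κ) (y, ν) = if (⟨z, κ⟩ : PBond P 0) = ⟨y, ν⟩ then 1 else 0 := by
  have h := ofLp_HkE_single h0 (one_ne_zero) (zero_lt_one) ha ⟨y, ν⟩ z κ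
  rw [HkE_zero P one_ne_zero zero_lt_one, LinearMap.id_apply] at h
  simp only at h
  rw [← h]
  show (Pi.single (⟨y, ν⟩ : PBond P 0) (1 : ℝ) : PBond P 0 → ℝ) ⟨z, κ⟩ = _
  by_cases hb : (⟨z, κ⟩ : PBond P 0) = ⟨y, ν⟩
  · rw [if_pos hb, hb, Pi.single_eq_same]
  · rw [if_neg hb, Pi.single_eq_of_ne hb]

/-- **`|H_0((x,μ),(y,ν))| ≤ Me^{−δ|x − y|}` for any `M ≥ 1` and any `δ`** (the identity kernel: `1` on the diagonal, where `|x − y| = 0`,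
and `0` elsewhere). [cite: BalabanImbrieJaffe1985, (4.4.4) p.312] -/
theorem abs_H_zero_le {P : Params} (h0 : 0 ≤ P.m + P.K) {a : ℝ} (ha : 0 < a) {M : ℝ} (hM : 1 ≤ M) (δ : ℝ)
    (μ ν : Fin P.d) (x y : TSite P 0) :
    |(torusRep P 0 (deltaAData h0 a)).H (x, μ) (y, ν)| ≤ M * Real.exp (-(δ * distEU P 0 x y)) := by
  rw [H_zero_apply h0 ha]
  split_ifs with hb
  · have hxy : x = y := congrArg PBond.src hb
    subst hxy
    have hdist : distEU P 0 x x = 0 := by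
      have hctr : ctr 0 x = x := by
        funext m
        simp [ctr]
      rw [distEU, hctr, (B3TorusRadialSums.supDist_eq_zero_iff x x).2 rfl, Nat.cast_zero, zero_div]
    rw [hdist, mul_zero, neg_zero, Real.exp_zero, mul_one, abs_one]
    exact hM
  · rw [abs_zero]; exact mul_nonneg (by linarith) (Real.exp_pos _).le

/-! ## §4  (7.2.4) over all tori -/

/-- **ROW C1.Eq7.2.4 OVER ALL TORI, explicit constants**: for EVERY torus `P` with `P.d = d` and EVERY scale `k ≤ m + K` at which the
three [6I] Prop. 1.2 members hold with constants `(C, C_α, δ₀)`, r15's `KernelData.Ineq724 M δ` holds for p09's Sect. 7.2 carrier with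
`D_k = λ(H_k(·; b))(x)` (`BIJ85Ineq724Proof.Dk` at `c = L^k`) with `M = d·const722(d,…)·e^{3δ/2}`, `δ = rate722(d,…)` — functions of
`(d, a, C, δ₀)` ONLY (p09's `ineq724_torusKernelData` read at `P.d = d`): p. 326 *"|D_k(x, b)| ≤ Me^{−δdist(x,b)}. (7.2.4) This estimate
follows from (5.1.4) and (7.2.2)"*. [cite: BalabanImbrieJaffe1985, (7.2.4) p.326] -/
theorem ineq724_allTori {d : ℕ} {a C δ₀ : ℝ} {Cα : ℝ → ℝ} (ha : 0 < a) {P : Params} (hPd : P.d = d) {k : ℕ} (hk : k ≤ P.m + P.K)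
    (h12 : (torusRep P k (deltaAData hk a)).Prop12Hyps C Cα δ₀) (Ck : Fin P.d → Fin P.d → TSite P k → TSite P k → ℝ) :
    (torusKernelData P k (deltaAData hk a) (PBond P k) (fun x b => distEU P k x b.src) Ck
        (Dk ((P.L : ℝ) ^ k) k (fun μ ν x y => (torusRep P k (deltaAData hk a)).H (x, μ) (y, ν)))).Ineq724
      (d * (const722 d C δ₀ (T4GaugeActionRate.gam0 d / (4 * d + a)) 1 1 1 (fun t : ℝ => (2 * (1 + (d : ℝ) / t)) ^ d) *
          Real.exp (rate722 d C δ₀ (T4GaugeActionRate.gam0 d / (4 * d + a)) 1 1 1 (fun t : ℝ => (2 * (1 + (d : ℝ) / t)) ^ d) * (1 / 2))) *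
        Real.exp (rate722 d C δ₀ (T4GaugeActionRate.gam0 d / (4 * d + a)) 1 1 1 (fun t : ℝ => (2 * (1 + (d : ℝ) / t)) ^ d) * (1 / 2 + 1 / 2)))
      (rate722 d C δ₀ (T4GaugeActionRate.gam0 d / (4 * d + a)) 1 1 1 (fun t : ℝ => (2 * (1 + (d : ℝ) / t)) ^ d)) := by
  subst hPd
  exact ineq724_torusKernelData hk (torusHyps_deltaA hk ha) h12 Ck

/-- **(7.2.4) OVER ALL TORI FROM [6I] PROP. 1.2 BY ITS TREE NAME**: ONE `δ > 0` and ONE `M` with `KernelData.Ineq724 M δ` —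
`|D_k(x, b)| ≤ Me^{−δ·dist(x,b)}` — for p09's carrier on EVERY torus `P` (`P.d = d`, `P.L = L`) and EVERY scale `1 ≤ k ≤ m + K`
(*"independent of k, T_η"*). [cite: BalabanImbrieJaffe1985, (7.2.4) p.326] -/
theorem exists_ineq724_allTori_of_prop12Printed {d L : ℕ} (hd : 1 ≤ d) (hL : Odd L ∧ 1 < L) {a : ℝ} (ha : 0 < a)
    (h12 : B5.Prop12Printed (fun i : {x : Params × ℕ // x.1.d = d ∧ x.1.L = L ∧ 1 ≤ x.2 ∧ x.2 ≤ x.1.m + x.1.K} =>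
      settingOf (torusRep i.1.1 i.1.2 (deltaAData i.2.2.2.2 a)) i.1.2)) :
    ∃ M δ : ℝ, 0 < δ ∧ ∀ (P : Params) (hPd : P.d = d) (hPL : P.L = L) (k : ℕ) (hk1 : 1 ≤ k) (hk : k ≤ P.m + P.K)
      (Ck : Fin P.d → Fin P.d → TSite P k → TSite P k → ℝ),
      (torusKernelData P k (deltaAData hk a) (PBond P k) (fun x b => distEU P k x b.src) Ck
        (Dk ((P.L : ℝ) ^ k) k (fun μ ν x y => (torusRep P k (deltaAData hk a)).H (x, μ) (y, ν)))).Ineq724 M δ := by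
  obtain ⟨C, δ₀, Cα, hC, hδ₀, hall⟩ := prop12Hyps_allTori_of_prop12Printed h12
  set P₀ : Params := ⟨d, L, 0, 1, hd, hL⟩ with hP₀
  have hk₀ : 1 ≤ P₀.m + P₀.K := le_rfl
  have hH₀ := hyps_torus_deltaA_dim (P := P₀) (d := d) rfl hk₀ ha
  have h12₀ := hall P₀ rfl rfl 1 le_rfl hk₀
  have hrpos : 0 < rate722 d C δ₀ (T4GaugeActionRate.gam0 d / (4 * d + a)) 1 1 1 (fun t : ℝ => (2 * (1 + (d : ℝ) / t)) ^ d) := rate722_pos hH₀ h12₀ d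
  exact ⟨_, _, hrpos, fun P hPd hPL k hk1 hk Ck => ineq724_allTori ha hPd hk (hall P hPd hPL k hk1 hk) Ck⟩

/-! ## §5  «The operators 𝒟_k have the same properties as the operators G_k in [6I], Proposition 1.2, with exponential decay» over all tori -/

/-- **THE `𝒟_k`-DECAY SENTENCE OF p. 326 OVER ALL TORI FROM [6I] PROP. 1.2 BY ITS TREE NAME** (`d ≥ 2`): ONE `(R₀, c₀, δ′)`, `δ′ > 0`,
`c₀ ≥ 0`, with `|𝒟_k(b, b″)| ≤ c₀e^{−δ′|b₋ − b″₋|_∞/L^k}` whenever `|b₋ − b″₋|_∞/L^k ≥ R₀`, for p11's `𝒟_k = DkE P η_k^d L^k k` of (4.4.4)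
on EVERY torus `P` (`P.d = d`, `P.L = L`) and EVERY `k ≤ m + K` — p08's explicit `abs_dkKernel_le` fed with the all-tori `|H|` member of
(7.2.2) (§2; the scale-0 summand by §3) and p09's all-tori (7.2.3) `ineq723_CE_lt` (hypothesis-free): *"These properties follow from
(4.4.4) and the above estimates on H_k, C^{(k)}"*. [cite: BalabanImbrieJaffe1985, (4.4.4) p.312] -/
theorem decayDk_allTori_of_prop12Printed {d L : ℕ} (hd : 2 ≤ d) (hL : Odd L ∧ 1 < L) {a : ℝ} (ha : 0 < a)
    (h12 : B5.Prop12Printed (fun i : {x : Params × ℕ // x.1.d = d ∧ x.1.L = L ∧ 1 ≤ x.2 ∧ x.2 ≤ x.1.m + x.1.K} =>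
      settingOf (torusRep i.1.1 i.1.2 (deltaAData i.2.2.2.2 a)) i.1.2)) :
    ∃ R₀ c₀ δ' : ℝ, 0 < δ' ∧ 0 ≤ c₀ ∧ ∀ (P : Params) (hPd : P.d = d) (hPL : P.L = L) (k : ℕ) (hk : k ≤ P.m + P.K)
      (b b'' : PBond P 0), R₀ ≤ (supDist b.src b''.src : ℝ) / (P.L : ℝ) ^ k →
        |DkE P ((P.eta k) ^ P.d) ((P.L : ℝ) ^ k) k (toE P (Pi.single b'' 1)) b| ≤
          c₀ * Real.exp (-δ' * ((supDist b.src b''.src : ℝ) / (P.L : ℝ) ^ k)) := by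
  obtain ⟨δ, M, hδ, hM, hH⟩ := exists_absH_le_allTori_of_prop12Printed (le_trans one_le_two hd) hL ha h12
  obtain ⟨MC, δC, hMC, hδC, hC⟩ := ineq723_CE_lt d L hd
  refine ⟨2, M ^ 2 * MC * ((d : ℝ) ^ 2 * (Real.exp (min δ δC / 2 / 2) * ((2 * (1 + d / (min δ δC / 2))) ^ d) ^ 2)) *
      (((d - 2 + 1).factorial : ℝ) / (min δ δC / 2) ^ (d - 2 + 1)), min δ δC / 2 / 2, ?_, ?_,
    fun P hPd hPL k hk b b'' hfar => ?_⟩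
  · have := lt_min hδ hδC; positivity
  · have := lt_min hδ hδC; positivity
  have hHP : ∀ (j : ℕ) (hj : j ≤ P.m + P.K), j < k → ∀ (μ ν : Fin P.d) (x : TSite P 0) (y : TSite P j),
      |(torusRep P j (deltaAData hj a)).H (x, μ) (y, ν)| ≤ M * Real.exp (-(δ * distEU P j x y)) := by
    intro j hj _ μ ν x y
    rcases Nat.eq_zero_or_pos j with hj0 | hj1
    · subst hj0
      exact abs_H_zero_le hj ha hM δ μ ν x y
    · exact hH P hPd hPL j hj1 hj μ ν x y
  have hCP : ∀ j < k, ∀ b₁ b₂ : PBond P j, |⟪toEj P j (Pi.single b₁ 1),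
      CE P ((P.eta j) ^ P.d) ((P.L : ℝ) ^ j) j (toEj P j (Pi.single b₂ 1))⟫| ≤
        MC * Real.exp (-(δC * (supDist b₁.src b₂.src : ℝ))) :=
    fun j hjk b₁ b₂ => hC P hPd hPL k hk j inferInstance hjk b₁ b₂
  subst hPd
  rw [neg_mul]
  exact abs_dkKernel_le hd hk ha hδ hδC hMC.le hHP hCP hfar

end

end Literature.MathematicalPhysics.QuantumFieldTheory.BalabanImbrieJaffe1984to88.BIJ85Sect72AllTori
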